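import Literature.AnabelianGeometry.EtaleTheta.Discharge.Sec1EvalAtNaturality
import Literature.AnabelianGeometry.EtaleTheta.Discharge.Sec1OrbitGenerator
import Literature.AnabelianGeometry.EtaleTheta.Discharge.Sec1SingleClassValueLaw
import Literature.AnabelianGeometry.EtaleTheta.ConstantMultipleRigidityUniqueProofs
import HarnessLib

/-!
# [EtTh] Thm. 1.10 (i) «up to ±1» — CAPSTONE at the model: ONE printed value sentence left
# (abc-iut-L2-lead (gen 3) R12: K2 capstone, holder abc-iut-L2-t6)

S. Mochizuki, *The étale theta function …*, Publ. RIMS **45** (2009), §1, Thm. 1.10 (i) p. 30 (printed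
256), Def. 1.9 (i)(ii) p. 29, Prop. 1.4 (ii)(iii) p. 22 [cite: MochizukiEtTh2009, Thm 1.10 (i) p.30].
Layer L2 of the abc-iut cell, seat abc-iut-L2-t6 (gen 4). PROOF-ONLY assembly (no `def`) of:
abc-iut-L2-d1's `MuTwoSetting.exists_translatePoints_standard_of_prop15ii` (p420910: the points over
`τ^{±1}` as TRANSPORTS of `τ^{±1}` along `conj(σ₁^a)`, with prescribed coordinates and NATURAL evaluation,
from `Prop15ii` — K2 checklist items 5(a)(b)), this seat's `exists_orbit_generator` (p419021, (B2)),
`standardValuesFormulaSigned_of_dictionary` / `standardValuesInvSymm_of_dictionary` (p418439),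
abc-iut-w5-d140's `exists_val_families_of_lawOn` (p419834) and `thm110iUnique_of_signedFormula`
(p418589), abc-iut-w5-d234's `thm110UnitClassEquivariance_of_prop15ii` (p418922).

RESULT `MuTwoSetting.thm110iUnique_of_translateValues`: **`Thm110iUnique hC hZ E S` holds GIVEN**
t1's FACT `Prop15ii`, the parity of a lift of `ε_Z` (⇐ the printed characterisation of `ε_μ`, P-C8 /
`IsDef17Origin`), the branch sign `s = ±1`, a reference theta class `κ₀`, and ONE printed sentence as
binder — the TRANSLATE VALUE LAW AT `τ^{±1}`: «for the generator `σ₁` of `Π^tp_Ẋ/Π^tp_Ÿ`, the class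
`conj(σ₁^a) κ₀` evaluates at `τ` (resp. `τ⁻¹`) to the unit `Θ̈((s q̈)^a √−1)` (resp. `Θ̈((s q̈)^a (√−1)⁻¹)`)»
= Prop. 1.4 (ii) at the class level read through Prop. 1.4 (iii) at `τ^{±1}` (the K2 checklist's 5(c) at
the transported points; G-L2t6g4-2 residual). Everything else — orbit, naturality, coordinates, the two
value formulas, minimal-norm uniqueness, the `±1` bookkeeping — is kernel-proved. Also
`sign_mul_qdd_zpow_mul_ne_cusp`: the prescribed coordinates `(s q̈)^a √−1^{±1}` are non-cuspidal.
HONEST FRAMING: conditional on the named binder and on `Prop15ii`; typed ≠ proved for [EtTh]; nothing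
here bears on the disputed [IUTchIII] Cor. 3.12.
-/

noncomputable section

namespace Literature.AnabelianGeometry.EtaleTheta

open Literature.AnabelianGeometry.SemiGraphs

namespace MuTwoSetting

variable {p : ℕ} [Fact p.Prime] {M : MuTwoSetting p}

/-- The prescribed coordinates are NON-CUSPIDAL: `(s q̈)^a · ζ' ≠ ±q̈^b` for `s = ±1` and any `ζ'` with
`ζ'² = −1` (`0 < ‖q̈‖ < 1`: norms force `a = b`, then `ζ'² = 1 ≠ −1`). [cite: MochizukiEtTh2009, Def 1.9 p.29] -/
theorem sign_mul_qdd_zpow_mul_ne_cusp {s ζ : PadicAlgCl p} (hs : s = 1 ∨ s = -1) (hζ : ζ ^ 2 = -1)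
    (a b : ℤ) : (s * M.toThetaSetting.qdd) ^ a * ζ ≠ M.toThetaSetting.qdd ^ b ∧
      (s * M.toThetaSetting.qdd) ^ a * ζ ≠ -(M.toThetaSetting.qdd ^ b) := by
  have hq0 : M.toThetaSetting.qdd ≠ 0 := qdd_ne_zero
  have hq1 : ‖M.toThetaSetting.qdd‖ < 1 := norm_qdd_lt_one
  have hqpos : 0 < ‖M.toThetaSetting.qdd‖ := norm_pos_iff.mpr hq0
  have hs1 : ‖s‖ = 1 := by rcases hs with rfl | rfl <;> simp
  have hs2 : s ^ 2 = 1 := by rcases hs with rfl | rfl <;> norm_num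
  have hζ1 : ‖ζ‖ = 1 := by
    have h : ‖ζ‖ ^ 2 = 1 := by rw [← norm_pow, hζ, norm_neg, norm_one]
    nlinarith [norm_nonneg ζ]
  -- a common core: `(s q̈)^a ζ = ε q̈^b` with `ε = ±1` is impossible
  have key : ∀ ε : PadicAlgCl p, ε ^ 2 = 1 → ‖ε‖ = 1 →
      (s * M.toThetaSetting.qdd) ^ a * ζ ≠ ε * M.toThetaSetting.qdd ^ b := by
    intro ε hε hε1 h
    -- norms: `‖q̈‖^a = ‖q̈‖^b`, so `a = b`
    have hn : ‖M.toThetaSetting.qdd‖ ^ a = ‖M.toThetaSetting.qdd‖ ^ b := by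
      have := congrArg (fun x => ‖x‖) h
      simpa [norm_mul, norm_zpow, mul_zpow, hs1, hζ1, hε1] using this
    have hab : a = b := zpow_right_injective₀ hqpos hq1.ne hn
    subst hab
    -- cancel `q̈^a`: `s^a ζ = ε`, square: `ζ² = 1`
    have hqa : M.toThetaSetting.qdd ^ a ≠ 0 := zpow_ne_zero a hq0
    have h2 : s ^ a * ζ = ε := by
      have h' : (s ^ a * ζ) * M.toThetaSetting.qdd ^ a = ε * M.toThetaSetting.qdd ^ a := by
        rw [← h, mul_zpow]; ring
      exact mul_right_cancel₀ hqa h'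
    have h3 : ζ ^ 2 = 1 := by
      have hsq : (s ^ a * ζ) ^ 2 = 1 := by rw [h2, hε]
      have hsa : (s ^ a) ^ 2 = 1 := by
        rcases hs with rfl | rfl
        · simp
        · rw [← zpow_natCast, ← zpow_mul]
          exact Even.neg_one_zpow ⟨a, by ring⟩
      rwa [mul_pow, hsa, one_mul] at hsq
    rw [hζ] at h3
    have : (2 : PadicAlgCl p) = 0 := by linear_combination -h3
    exact two_ne_zero this
  refine ⟨?_, ?_⟩
  · simpa using key 1 (one_pow 2) norm_one
  · have h := key (-1) (by norm_num) (by simp)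
    simpa [neg_one_mul] using h

/-- **[EtTh] Thm. 1.10 (i) «determines this collection of classes up to multiplication by ±1» — capstone
at the model.** For an admissible `ε_Z` with a lift `σ_Z` of odd `toZ` (⇐ the printed characterisation
of `ε_μ`), an étale theta datum `E` with t1's FACT `Prop15ii`, standard data `S`, the branch sign `s`,
and a reference theta class `κ₀`: IF for the generator `σ₁` of `Π^tp_Ẋ/Π^tp_Ÿ` the translates
`conj(σ₁^a) κ₀` evaluate at `τ` / `τ⁻¹` to (units of `K̈` equal to) `Θ̈((s q̈)^a √−1)` / `Θ̈((s q̈)^a (√−1)⁻¹)`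
— Prop. 1.4 (ii)+(iii) at the class level, the ONE remaining printed sentence — THEN `Thm110iUnique`:
`η̈^{Θ,ℤ}` and `(u·η̈)^{Θ,ℤ}` both of standard type forces `u = ±1`. The points over `τ^{±1}` are
CONSTRUCTED (abc-iut-L2-d1, p420910) with natural evaluation; the value formulas, orbit and uniqueness
are this seat's p418439/p419021 and abc-iut-w5-d140's p418589/p419834; (V2′) is `Prop15ii`
(abc-iut-w5-d234). [cite: MochizukiEtTh2009, Thm 1.10 (i) p.30] -/
theorem thm110iUnique_of_translateValues (hC : M.toThetaSetting.Compat) {εZ : M.GtpC}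
    (hZ : M.IsAdmissibleEpsZ εZ) (E : M.toThetaSetting.EtaleThetaData)
    (S : M.StandardData E.toKummerData) (h15ii : ThetaSetting.Prop15ii E.toKummerData hC)
    {κ₀ : M.toThetaSetting.H1 M.toThetaSetting.GtpYdd} (hκ₀mem : κ₀ ∈ E.thetaClasses)
    {σZ : M.PiTemp} (hσZ : M.inclX σZ = εZ) (hodd : Odd (Multiplicative.toAdd (M.toZ σZ)))
    {s : PadicAlgCl p} (hs : s = 1 ∨ s = -1)
    (w w' : ℤ → (↥M.Kdd)ˣ)
    (hw : ∀ a : ℤ, ((w a : M.Kdd) : PadicAlgCl p) = (s * M.toThetaSetting.qdd) ^ a * S.sqrtNegOne)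
    (hw' : ∀ a : ℤ, ((w' a : M.Kdd) : PadicAlgCl p) =
      (s * M.toThetaSetting.qdd) ^ a * S.sqrtNegOne⁻¹)
    (htv : haveI := hC.GtpYdd_normal
      ∀ σ₁ : M.PiTemp, M.inclX σ₁ ∈ M.dotX εZ → Multiplicative.toAdd (M.toZ σ₁) = 1 →
      ∀ a : ℤ, ∃ v : (↥M.Kdd)ˣ, ((v : M.Kdd) : PadicAlgCl p) =
          thetaDdot M.toThetaSetting.qdd ((s * M.toThetaSetting.qdd) ^ a * S.sqrtNegOne) ∧
        S.tau.evalAt (ContH1.res M.toTheta M.toThetaSetting.DeltaTheta S.tau.Dpt_le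
          (ContH1.conj M.toTheta M.toThetaSetting.DeltaTheta (σ₁ ^ a) κ₀)) = E.toKddHat v)
    (htv' : haveI := hC.GtpYdd_normal
      ∀ σ₁ : M.PiTemp, M.inclX σ₁ ∈ M.dotX εZ → Multiplicative.toAdd (M.toZ σ₁) = 1 →
      ∀ a : ℤ, ∃ v : (↥M.Kdd)ˣ, ((v : M.Kdd) : PadicAlgCl p) =
          thetaDdot M.toThetaSetting.qdd ((s * M.toThetaSetting.qdd) ^ a * S.sqrtNegOne⁻¹) ∧
        S.tauInv.evalAt (ContH1.res M.toTheta M.toThetaSetting.DeltaTheta S.tauInv.Dpt_le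
          (ContH1.conj M.toTheta M.toThetaSetting.DeltaTheta (σ₁ ^ a) κ₀)) = E.toKddHat v) :
    Thm110iUnique hC hZ E S := by
  haveI := hC.GtpYdd_normal
  have hη : E.etaDd ∈ E.thetaClasses := ⟨1, one_mem _, (one_mul _).symm⟩
  have hζinv : S.sqrtNegOne⁻¹ ^ 2 = -1 := by rw [inv_pow, S.sqrtNegOne_sq, inv_neg, inv_one]
  -- (B2) the generator
  obtain ⟨σ₁, hσ₁X, hσ₁Z, hgen⟩ := exists_orbit_generator hσZ hodd
  -- (B1/B3) the transported points over `τ`, `τ⁻¹` with the prescribed coordinates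
  have hwad : ∀ a b : ℤ, ((w a : M.Kdd) : PadicAlgCl p) ≠ M.toThetaSetting.qdd ^ b ∧
      ((w a : M.Kdd) : PadicAlgCl p) ≠ -(M.toThetaSetting.qdd ^ b) := fun a b => by
    rw [hw a]; exact sign_mul_qdd_zpow_mul_ne_cusp hs S.sqrtNegOne_sq a b
  have hwad' : ∀ a b : ℤ, ((w' a : M.Kdd) : PadicAlgCl p) ≠ M.toThetaSetting.qdd ^ b ∧
      ((w' a : M.Kdd) : PadicAlgCl p) ≠ -(M.toThetaSetting.qdd ^ b) := fun a b => by
    rw [hw' a]; exact sign_mul_qdd_zpow_mul_ne_cusp hs hζinv a b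
  obtain ⟨τ_, τ'_, hnat, hnat', hcw, hcw', -, -⟩ :=
    M.exists_translatePoints_standard_of_prop15ii hC h15ii S σ₁ w w' hwad hwad'
  have hcoord : ∀ a : ℤ, (((τ_ a).coord : M.Kdd) : PadicAlgCl p) =
      (s * M.toThetaSetting.qdd) ^ a * S.sqrtNegOne := fun a => by rw [hcw a, hw a]
  have hcoord' : ∀ a : ℤ, (((τ'_ a).coord : M.Kdd) : PadicAlgCl p) =
      (s * M.toThetaSetting.qdd) ^ a * S.sqrtNegOne⁻¹ := fun a => by rw [hcw' a, hw' a]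
  -- (B4) the reference-class law AT these points, from the translate value law at `τ^{±1}`
  have hlaw : ∀ a : ℤ, ∃ v : (↥M.Kdd)ˣ, ((v : M.Kdd) : PadicAlgCl p) =
      thetaDdot M.toThetaSetting.qdd (((τ_ a).coord : M.Kdd) : PadicAlgCl p) ∧
      (τ_ a).evalAt (ContH1.res M.toTheta M.toThetaSetting.DeltaTheta (τ_ a).Dpt_le κ₀) =
        E.toKddHat v := fun a => by
    obtain ⟨v, hv, hev⟩ := htv σ₁ hσ₁X hσ₁Z a
    exact ⟨v, by rw [hcoord a, hv], by rw [← hnat a κ₀, hev]⟩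
  have hlaw' : ∀ a : ℤ, ∃ v : (↥M.Kdd)ˣ, ((v : M.Kdd) : PadicAlgCl p) =
      thetaDdot M.toThetaSetting.qdd (((τ'_ a).coord : M.Kdd) : PadicAlgCl p) ∧
      (τ'_ a).evalAt (ContH1.res M.toTheta M.toThetaSetting.DeltaTheta (τ'_ a).Dpt_le κ₀) =
        E.toKddHat v := fun a => by
    obtain ⟨v, hv, hev⟩ := htv' σ₁ hσ₁X hσ₁Z a
    exact ⟨v, by rw [hcoord' a, hv], by rw [← hnat' a κ₀, hev]⟩
  obtain ⟨c, val, val', hval, hval', heval, heval', -⟩ :=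
    E.exists_val_families_of_lawOn hκ₀mem τ_ τ'_ hlaw hlaw' hη
  -- V1″ and (b₂) at the model, then w5-d140's composition
  exact thm110iUnique_of_signedFormula hC hZ E S (thm110UnitClassEquivariance_of_prop15ii hC εZ h15ii)
    (standardValuesFormulaSigned_of_dictionary hC εZ S E.etaDd hσ₁X hgen τ_ (fun a => hnat a E.etaDd)
      hs hcoord val hval heval)
    (standardValuesInvSymm_of_dictionary hC εZ S E.etaDd hσ₁X hgen τ_ τ'_ (fun a => hnat a E.etaDd)
      (fun a => hnat' a E.etaDd) hs hcoord hcoord' val val' hval hval' heval heval')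

end MuTwoSetting

end Literature.AnabelianGeometry.EtaleTheta

end
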